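import Mathlib.Analysis.SpecialFunctions.SmoothTransition
import Mathlib.MeasureTheory.Integral.IntervalIntegral.FundThmCalculus
import Mathlib.Analysis.Calculus.ContDiff.Deriv
import Mathlib.Topology.Order.IntermediateValue
import Literature.Analysis.FluidPDE.GavrilovSteadyEuler
import HarnessLib

/-!
# Gavrilov's localisation step: from a local generalized-Beltrami germ to a global flow

Topic `Literature/Analysis/FluidPDE`; support file for the discharge of the named fact
`Literature.Analysis.FluidPDE.gavrilov_compact_steady_euler` (Gavrilov 2019, §1 Theorem).

Gavrilov (GAFA 29 (2019), §3, last paragraph) constructs his compactly supported flow from a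
*local* steady Euler flow `(u, p)` defined near the circle `𝒞 = {ρ = R, z = 0}` and enjoying
`u·∇p = 0`, a pressure vanishing exactly on `𝒞` with a strict minimum there (Lemma 4), and a
nonzero swirl: the modulated field `ũ = ω(p) u`, `dp̃ = ω(p)² dp`, with a smooth cutoff `ω`
supported in `p ∈ [ε, 2ε]`, is `C^∞` on `ℝ³`, compactly supported in an arbitrarily thin
toroidal shell around `𝒞`, and is again a steady Euler flow with `ũ·∇p̃ = 0`.  This file PROVES
that step in the tree's vocabulary (`Gavrilov.exists_global_of_local`), using the pointwise
modulation identities `Gavrilov.steadyEuler_modulate` of `GavrilovSteadyEuler.lean`; the output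
is literally the `∃ U P, …` block of `gavrilov_compact_steady_euler` (for the given radius and
every thickness `δ > 0`).

## Contents

* `Gavrilov.axisCircle R` — the circle `{cylRadius x = R, x 2 = 0}` (compact; invariant under the
  rotations `rotZ`), `Gavrilov.bump ε` — the cutoff `ω(t) = e(t − ε) e(2ε − t)` built from
  Mathlib's `expNegInvGlue` (smooth, `= 0` off `(ε, 2ε)`, `> 0` inside), `Gavrilov.bumpPrim ε`
  — its primitive `∫₀ᵗ ω²` (smooth, `0` below `ε`, constant above `2ε`).
* `Gavrilov.exists_global_of_local` — the localisation theorem.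

## Proof sketch (Gavrilov 2019, §3; all elementary)

Pick `r > 0` with the closed `r`-neighbourhood `N̄_r` of `𝒞` inside the domain `O`, and
`r' = min r δ / 2`.  On the compact set `N̄_r ∖ N_{r'}` the pressure is continuous and positive,
hence `≥ η > 0`; put `ε = η/4`.  Then `T = {x ∈ N̄_r : p x ≤ 2ε}` is compact, contained in
`N_{r'}`, and `Ũ = 𝟙_{N_r} ω(p) u`, `P̃ = 𝟙_{N_r} (Φ(p) − Φ(2ε))` (`Φ' = ω²`) vanish, resp. are
locally constant, off `T` and near `𝒞`; elsewhere they agree locally with the modulated germ, so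
they are smooth and solve the equations by `steadyEuler_modulate`.  A point with `p = 3ε/2` on
the radial segment from `(R,0,0)` (intermediate value theorem) carries nonzero swirl.

## References

* A. V. Gavrilov, *A steady Euler flow with compact support*, Geom. Funct. Anal. 29 (2019)
  190–197, §3 (last paragraph: the modulation `ũ = ω(p)u`, `supp ω ⊆ [ε, 2ε]`), Lemma 4.
  [`Gavrilov2019`]
* P. Constantin, J. La, V. Vicol, *Remarks on a paper by Gavrilov…*, Geom. Funct. Anal. 29
  (2019) 1773–1793, §2 (localisation `ũ = φ(p)u`). [`ConstantinLaVicol2019`]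
-/

noncomputable section

open Set Metric Filter Function
open scoped Topology

namespace Literature.Analysis.FluidPDE

local notation "ℝ³" => EuclideanSpace ℝ (Fin 3)

namespace Gavrilov

/-! ### The circle and the rotations about the axis -/

/-- The horizontal circle `𝒞_R = {ρ = R, z = 0}` of radius `R` centred on the symmetry axis
(Gavrilov 2019, §3: "denote by `𝒞` the circle `ρ = R, z = 0`"). [cite: Gavrilov2019, §3] -/
def axisCircle (R : ℝ) : Set ℝ³ := {x | cylRadius x = R ∧ x 2 = 0}

/-- Membership in the circle `𝒞_R`. [folklore] -/
theorem mem_axisCircle {R : ℝ} {x : ℝ³} : x ∈ axisCircle R ↔ cylRadius x = R ∧ x 2 = 0 :=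
  Iff.rfl

/-- The circle `𝒞_R` is closed. [folklore] -/
theorem isClosed_axisCircle (R : ℝ) : IsClosed (axisCircle R) := by
  have h1 : IsClosed {x : ℝ³ | cylRadius x = R} := isClosed_eq continuous_cylRadius continuous_const
  have h2 : IsClosed {x : ℝ³ | x 2 = 0} := isClosed_eq (by fun_prop) continuous_const
  exact h1.inter h2

/-- Points of `𝒞_R` have norm `R`. [folklore] -/
theorem norm_eq_of_mem_axisCircle {R : ℝ} (hR : 0 ≤ R) {x : ℝ³} (hx : x ∈ axisCircle R) :
    ‖x‖ = R := by
  rw [EuclideanSpace.norm_eq, Fin.sum_univ_three]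
  simp only [Real.norm_eq_abs, sq_abs, hx.2]
  rw [← cylRadius_sq, hx.1]
  simpa using Real.sqrt_sq hR

/-- The circle `𝒞_R` is compact. [folklore] -/
theorem isCompact_axisCircle {R : ℝ} (hR : 0 ≤ R) : IsCompact (axisCircle R) :=
  Metric.isCompact_of_isClosed_isBounded (isClosed_axisCircle R)
    ((Metric.isBounded_closedBall (x := (0 : ℝ³)) (r := R)).subset fun x hx => by
      rw [mem_closedBall_zero_iff, norm_eq_of_mem_axisCircle hR hx])

/-- Rotations about the axis are additive: `R_θ (x − y) = R_θ x − R_θ y`. [folklore] -/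
theorem rotZ_sub (θ : ℝ) (x y : ℝ³) : rotZ θ (x - y) = rotZ θ x - rotZ θ y := by
  ext i
  fin_cases i <;> simp <;> ring

/-- `R_θ 0 = 0`. [folklore] -/
theorem rotZ_zero_vec (θ : ℝ) : rotZ θ (0 : ℝ³) = 0 := by
  ext i
  fin_cases i <;> simp

/-- Rotations about the axis preserve distances. [folklore] -/
theorem dist_rotZ (θ : ℝ) (x y : ℝ³) : dist (rotZ θ x) (rotZ θ y) = dist x y := by
  rw [dist_eq_norm, dist_eq_norm, ← rotZ_sub, norm_rotZ]

/-- `R_{-θ} ∘ R_θ = id`. [folklore] -/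
theorem rotZ_neg_rotZ (θ : ℝ) (x : ℝ³) : rotZ (-θ) (rotZ θ x) = x := by
  rw [← rotZ_add, neg_add_cancel, rotZ_zero]

/-- The circle `𝒞_R` is invariant under the rotations about the axis. [folklore] -/
theorem rotZ_mem_axisCircle {R θ : ℝ} {x : ℝ³} (hx : x ∈ axisCircle R) :
    rotZ θ x ∈ axisCircle R :=
  ⟨by rw [cylRadius_rotZ]; exact hx.1, by rw [rotZ_apply_two]; exact hx.2⟩

/-- The open `r`-neighbourhood of `𝒞_R` is invariant under the rotations about the axis.
[folklore] -/
theorem rotZ_mem_thickening_axisCircle_iff {R r θ : ℝ} {x : ℝ³} :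
    rotZ θ x ∈ thickening r (axisCircle R) ↔ x ∈ thickening r (axisCircle R) := by
  constructor
  · intro h
    obtain ⟨z, hz, hd⟩ := mem_thickening_iff.1 h
    refine mem_thickening_iff.2 ⟨rotZ (-θ) z, rotZ_mem_axisCircle hz, ?_⟩
    rwa [← rotZ_neg_rotZ θ x, dist_rotZ]
  · intro h
    obtain ⟨z, hz, hd⟩ := mem_thickening_iff.1 h
    exact mem_thickening_iff.2 ⟨rotZ θ z, rotZ_mem_axisCircle hz, by rwa [dist_rotZ]⟩

/-! ### The cutoff `ω` and its primitive -/

/-- The cutoff `ω_ε(t) = e(t − ε) · e(2ε − t)` with `e = expNegInvGlue`: smooth, vanishing off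
`(ε, 2ε)`, positive on `(ε, 2ε)` (Gavrilov 2019, §3: "`supp ω ⊂ [ε, 2ε]`"). [cite: Gavrilov2019, §3] -/
def bump (ε t : ℝ) : ℝ := expNegInvGlue (t - ε) * expNegInvGlue (2 * ε - t)

/-- The cutoff is smooth. [folklore] -/
theorem contDiff_bump (ε : ℝ) {n : ℕ∞} : ContDiff ℝ n (bump ε) := by
  have h1 : ContDiff ℝ n fun t : ℝ => expNegInvGlue (t - ε) :=
    expNegInvGlue.contDiff.comp (contDiff_id.sub contDiff_const)
  have h2 : ContDiff ℝ n fun t : ℝ => expNegInvGlue (2 * ε - t) :=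
    expNegInvGlue.contDiff.comp (contDiff_const.sub contDiff_id)
  exact h1.mul h2

/-- The cutoff is continuous. [folklore] -/
theorem continuous_bump (ε : ℝ) : Continuous (bump ε) :=
  (contDiff_bump ε (n := 0)).continuous

/-- The cutoff vanishes below `ε`. [folklore] -/
theorem bump_eq_zero_of_le {ε t : ℝ} (h : t ≤ ε) : bump ε t = 0 := by
  simp [bump, expNegInvGlue.zero_of_nonpos (sub_nonpos.2 h)]

/-- The cutoff vanishes above `2ε`. [folklore] -/
theorem bump_eq_zero_of_ge {ε t : ℝ} (h : 2 * ε ≤ t) : bump ε t = 0 := by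
  simp [bump, expNegInvGlue.zero_of_nonpos (sub_nonpos.2 h)]

/-- The cutoff is positive on `(ε, 2ε)`. [folklore] -/
theorem bump_pos {ε t : ℝ} (h1 : ε < t) (h2 : t < 2 * ε) : 0 < bump ε t :=
  mul_pos (expNegInvGlue.pos_of_pos (sub_pos.2 h1)) (expNegInvGlue.pos_of_pos (sub_pos.2 h2))

/-- The primitive `Φ_ε(t) = ∫₀ᵗ ω_ε²` of the squared cutoff: the modulated pressure is
`p̃ = Φ_ε(p) + const` (Gavrilov 2019, §3: "`dp̃ = ω²(p) dp`"). [cite: Gavrilov2019, §3] -/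
def bumpPrim (ε t : ℝ) : ℝ := ∫ τ in (0 : ℝ)..t, bump ε τ ^ 2

/-- `Φ_ε' = ω_ε²`. [folklore] -/
theorem hasDerivAt_bumpPrim (ε t : ℝ) : HasDerivAt (bumpPrim ε) (bump ε t ^ 2) t := by
  have hc : Continuous fun τ => bump ε τ ^ 2 := (continuous_bump ε).pow 2
  exact (hc.integral_hasStrictDerivAt 0 t).hasDerivAt

/-- `Φ_ε' = ω_ε²` as an equality of functions. [folklore] -/
theorem deriv_bumpPrim (ε : ℝ) : deriv (bumpPrim ε) = fun t => bump ε t ^ 2 :=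
  funext fun t => (hasDerivAt_bumpPrim ε t).deriv

/-- `Φ_ε` is smooth. [folklore] -/
theorem contDiff_bumpPrim (ε : ℝ) : ContDiff ℝ (⊤ : ℕ∞) (bumpPrim ε) := by
  rw [show ((⊤ : ℕ∞) : WithTop ℕ∞) = (⊤ : ℕ∞) from rfl, contDiff_infty_iff_deriv, deriv_bumpPrim]
  exact ⟨fun t => (hasDerivAt_bumpPrim ε t).differentiableAt, (contDiff_bump ε).pow 2⟩

/-- `Φ_ε = 0` below `ε` (for `ε ≥ 0`). [folklore] -/
theorem bumpPrim_of_le {ε t : ℝ} (hε : 0 ≤ ε) (ht : t ≤ ε) : bumpPrim ε t = 0 := by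
  unfold bumpPrim
  rw [intervalIntegral.integral_congr (g := fun _ => (0 : ℝ)), intervalIntegral.integral_zero]
  intro τ hτ
  have hτε : τ ≤ ε := by
    rcases le_total 0 t with h | h
    · rw [uIcc_of_le h] at hτ
      exact hτ.2.trans ht
    · rw [uIcc_of_ge h] at hτ
      exact hτ.2.trans hε
  simp [bump_eq_zero_of_le hτε]

/-- `Φ_ε` is constant above `2ε`. [folklore] -/
theorem bumpPrim_of_ge {ε t : ℝ} (ht : 2 * ε ≤ t) :
    bumpPrim ε t = bumpPrim ε (2 * ε) := by
  unfold bumpPrim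
  have hi : ∀ a b : ℝ, IntervalIntegrable (fun τ => bump ε τ ^ 2) MeasureTheory.volume a b :=
    fun a b => ((continuous_bump ε).pow 2).intervalIntegrable a b
  rw [← intervalIntegral.integral_add_adjacent_intervals (hi 0 (2 * ε)) (hi (2 * ε) t),
    intervalIntegral.integral_congr (g := fun _ => (0 : ℝ)) (a := 2 * ε),
    intervalIntegral.integral_zero, add_zero]
  intro τ hτ
  rw [uIcc_of_le ht] at hτ
  simp [bump_eq_zero_of_ge hτ.1]

/-! ### The localisation theorem -/

/-- **Gavrilov's localisation step** (Gavrilov 2019, §3, last paragraph, with Lemma 4 and §4;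
Constantin–La–Vicol 2019, §2).  Let `R > 0` and let `O ⊆ ℝ³` be an open neighbourhood of the
circle `𝒞 = 𝒞_R`.  Suppose `u : ℝ³ → ℝ³`, `p : ℝ³ → ℝ` are `C^∞` on `O ∖ 𝒞`, `p` is continuous on
`O`, `p = 0` on `𝒞` and `p > 0` on `O ∖ 𝒞` (strict minimum along the circle), `u` and `p` are
rotation-equivariant resp. -invariant on `O`, and on `O ∖ 𝒞`: `div u = 0`, `(u·∇)u + ∇p = 0`,
`u·∇p = 0` and the swirl `x₀u₁ − x₁u₀` does not vanish.  Then for every `δ > 0` there is a `C^∞`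
compactly supported steady Euler flow `(U, P)` on `ℝ³` (the modulation `U = ω(p)u`,
`dP = ω(p)²dp` extended by zero), `U ≠ 0`, supported in the `δ`-neighbourhood of `𝒞`,
axisymmetric with nonzero swirl, with compactly supported axisymmetric pressure, `div U = 0`,
`(U·∇)U + ∇P = 0` and `U·∇P = 0` everywhere — the `∃ U P` block of
`gavrilov_compact_steady_euler`. [cite: Gavrilov2019, §3 (last paragraph)] -/
theorem exists_global_of_local {R : ℝ} (hR : 0 < R) {O : Set ℝ³} (hO : IsOpen O)
    (hCO : axisCircle R ⊆ O) {u : ℝ³ → ℝ³} {p : ℝ³ → ℝ}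
    (hu : ContDiffOn ℝ (⊤ : ℕ∞) u (O \ axisCircle R))
    (hp : ContDiffOn ℝ (⊤ : ℕ∞) p (O \ axisCircle R)) (hpc : ContinuousOn p O)
    (hp0 : ∀ x ∈ axisCircle R, p x = 0) (hpos : ∀ x ∈ O \ axisCircle R, 0 < p x)
    (hua : ∀ θ, ∀ x ∈ O, u (rotZ θ x) = rotZ θ (u x))
    (hpa : ∀ θ, ∀ x ∈ O, p (rotZ θ x) = p x)
    (hdiv : ∀ x ∈ O \ axisCircle R, VectorCalculus.divergence u x = 0)
    (hE : ∀ x ∈ O \ axisCircle R, convect u u x + gradient p x = 0)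
    (horth : ∀ x ∈ O \ axisCircle R, fderiv ℝ p x (u x) = 0)
    (hsw : ∀ x ∈ O \ axisCircle R, swirl u x ≠ 0) {δ : ℝ} (hδ : 0 < δ) :
    ∃ (U : ℝ³ → ℝ³) (P : ℝ³ → ℝ),
      ContDiff ℝ (⊤ : ℕ∞) U ∧ ContDiff ℝ (⊤ : ℕ∞) P ∧ HasCompactSupport U ∧ HasCompactSupport P ∧
      U ≠ 0 ∧ tsupport U ⊆ Metric.thickening δ {x : ℝ³ | cylRadius x = R ∧ x 2 = 0} ∧
      IsAxisymmetric U ∧ IsAxisymmetricScalar P ∧ ¬ HasNoSwirl U ∧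
      VectorCalculus.IsDivFree U ∧ (∀ x, convect U U x + gradient P x = 0) ∧
      (∀ x, convect U P x = 0) := by
  set C := axisCircle R with hCdef
  have hCc : IsCompact C := isCompact_axisCircle hR.le
  have hCcl : IsClosed C := isClosed_axisCircle R
  -- Step 1: a compact tubular neighbourhood inside `O`, and the radii `r' < r`.
  obtain ⟨r, hr, hrO⟩ := hCc.exists_cthickening_subset_open hO hCO
  set r' := min r δ / 2 with hr'def
  have hr'pos : 0 < r' := by positivity
  have hr'r : r' < r := by
    have : min r δ ≤ r := min_le_left _ _
    rw [hr'def]; linarith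
  have hr'δ : r' < δ := by
    have : min r δ ≤ δ := min_le_right _ _
    rw [hr'def]; linarith
  -- Step 2: the pressure is bounded below by `η > 0` on the compact shell `K₀ = N̄_r ∖ N_{r'}`.
  set K₀ := cthickening r C \ thickening r' C with hK₀def
  have hK₀c : IsCompact K₀ := hCc.cthickening.diff isOpen_thickening
  have hK₀O : K₀ ⊆ O := fun x hx => hrO hx.1
  have hK₀C : ∀ x ∈ K₀, x ∉ C := fun x hx hxC => hx.2 (self_subset_thickening hr'pos C hxC)
  obtain ⟨η, hη, hηK⟩ : ∃ η : ℝ, 0 < η ∧ ∀ x ∈ K₀, η ≤ p x := by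
    rcases K₀.eq_empty_or_nonempty with h | hne
    · exact ⟨1, one_pos, by simp [h]⟩
    · obtain ⟨x₀, hx₀, hmin⟩ := hK₀c.exists_isMinOn hne (hpc.mono hK₀O)
      exact ⟨p x₀, hpos x₀ ⟨hK₀O hx₀, hK₀C x₀ hx₀⟩, fun x hx => isMinOn_iff.1 hmin x hx⟩
  -- Step 3: `ε = η / 4`, the open neighbourhood `N = N_r` and the compact shell `T`.
  set ε := η / 4 with hεdef
  have hε : 0 < ε := by positivity
  set N := thickening r C with hNdef
  have hN : IsOpen N := isOpen_thickening
  have hNO : N ⊆ O := (thickening_subset_cthickening r C).trans hrO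
  set T := cthickening r C ∩ p ⁻¹' Iic (2 * ε) with hTdef
  have hTcl : IsClosed T :=
    (hpc.mono hrO).preimage_isClosed_of_isClosed isClosed_cthickening isClosed_Iic
  have hTr' : T ⊆ thickening r' C := by
    intro x hx
    by_contra h
    have h1 := hηK x ⟨hx.1, h⟩
    have h2 : p x ≤ 2 * ε := hx.2
    rw [hεdef] at h2
    linarith
  have hTN : T ⊆ N := hTr'.trans (thickening_mono hr'r.le C)
  have hTO : T ⊆ O := fun x hx => hrO hx.1
  have hTc : IsCompact T := hCc.cthickening.of_isClosed_subset hTcl fun x hx => hx.1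
  -- Step 4: the modulated fields, extended by zero off `N`.
  set f : ℝ³ → ℝ³ := fun y => bump ε (p y) • u y with hfdef
  set g : ℝ³ → ℝ := fun y => bumpPrim ε (p y) - bumpPrim ε (2 * ε) with hgdef
  set U : ℝ³ → ℝ³ := N.indicator f with hUdef
  set P : ℝ³ → ℝ := N.indicator g with hPdef
  have hsuppU : support U ⊆ T := by
    intro x hx
    rw [mem_support] at hx
    by_cases hxN : x ∈ N
    · have hfx : f x ≠ 0 := by rwa [hUdef, indicator_of_mem hxN] at hx
      have hb : bump ε (p x) ≠ 0 := fun h0 => hfx (by simp [hfdef, h0])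
      have h2 : p x < 2 * ε := lt_of_not_ge fun h => hb (bump_eq_zero_of_ge h)
      exact ⟨thickening_subset_cthickening r C hxN, h2.le⟩
    · exact absurd (indicator_of_notMem hxN f) hx
  have hsuppP : support P ⊆ T := by
    intro x hx
    rw [mem_support] at hx
    by_cases hxN : x ∈ N
    · have hgx : g x ≠ 0 := by rwa [hPdef, indicator_of_mem hxN] at hx
      have h2 : p x < 2 * ε := lt_of_not_ge fun h => hgx (by
        simp [hgdef, bumpPrim_of_ge h])
      exact ⟨thickening_subset_cthickening r C hxN, h2.le⟩
    · exact absurd (indicator_of_notMem hxN g) hx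
  have htsU : tsupport U ⊆ T := closure_minimal hsuppU hTcl
  have htsP : tsupport P ⊆ T := closure_minimal hsuppP hTcl
  -- Step 5: the local dichotomy — near every point either `U ≡ 0` and `P` is constant, or we are
  -- inside `N ∩ (O ∖ 𝒞)` where `U = ω(p) u`, `P = Φ(p) − Φ(2ε)`.
  have key : ∀ x, (U =ᶠ[𝓝 x] (fun _ => 0) ∧ ∃ c : ℝ, P =ᶠ[𝓝 x] fun _ => c) ∨
      (x ∈ N ∧ x ∈ O ∧ x ∉ C) := by
    intro x
    by_cases hxT : x ∈ T
    · by_cases hxC : x ∈ C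
      · left
        have hxO : x ∈ O := hTO hxT
        have hxN : x ∈ N := hTN hxT
        have hpx : p x = 0 := hp0 x hxC
        have hcont : ContinuousAt p x := hpc.continuousAt (hO.mem_nhds hxO)
        have hev : ∀ᶠ y in 𝓝 x, p y < ε :=
          hcont.eventually (gt_mem_nhds (show p x < ε by rw [hpx]; exact hε))
        have hevN : ∀ᶠ y in 𝓝 x, y ∈ N := hN.mem_nhds hxN
        refine ⟨?_, ⟨-bumpPrim ε (2 * ε), ?_⟩⟩
        · filter_upwards [hev, hevN] with y hy hyN
          rw [hUdef, indicator_of_mem hyN, hfdef]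
          simp [bump_eq_zero_of_le hy.le]
        · filter_upwards [hev, hevN] with y hy hyN
          rw [hPdef, indicator_of_mem hyN, hgdef]
          simp [bumpPrim_of_le hε.le hy.le]
      · right
        exact ⟨hTN hxT, hTO hxT, hxC⟩
    · left
      have hev : ∀ᶠ y in 𝓝 x, y ∉ T := hTcl.isOpen_compl.mem_nhds hxT
      refine ⟨?_, ⟨0, ?_⟩⟩
      · filter_upwards [hev] with y hy
        exact notMem_support.1 fun h => hy (hsuppU h)
      · filter_upwards [hev] with y hy
        exact notMem_support.1 fun h => hy (hsuppP h)
  -- Step 6: pointwise smoothness and the equations.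
  have hpt : ∀ x, ContDiffAt ℝ (⊤ : ℕ∞) U x ∧ ContDiffAt ℝ (⊤ : ℕ∞) P x ∧
      VectorCalculus.divergence U x = 0 ∧ convect U U x + gradient P x = 0 ∧
      convect U P x = 0 := by
    intro x
    rcases key x with ⟨hU0, c, hPc⟩ | ⟨hxN, hxO, hxC⟩
    · have hfdU : fderiv ℝ U x = 0 := by
        rw [hU0.fderiv_eq]; exact fderiv_const_apply _
      have hfdP : fderiv ℝ P x = 0 := by
        rw [hPc.fderiv_eq]; exact fderiv_const_apply _
      refine ⟨contDiffAt_const.congr_of_eventuallyEq hU0,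
        contDiffAt_const.congr_of_eventuallyEq hPc, ?_, ?_, ?_⟩
      · simp [VectorCalculus.divergence, hfdU]
      · simp [convect, gradient, hfdU, hfdP]
      · simp [convect, hfdP]
    · have hxOC : x ∈ O \ C := ⟨hxO, hxC⟩
      have hnhds : O \ C ∈ 𝓝 x := (hO.sdiff hCcl).mem_nhds hxOC
      have hUf : U =ᶠ[𝓝 x] f := eventually_of_mem (hN.mem_nhds hxN) fun y hy => indicator_of_mem hy f
      have hPg : P =ᶠ[𝓝 x] g := eventually_of_mem (hN.mem_nhds hxN) fun y hy => indicator_of_mem hy g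
      have hpx : ContDiffAt ℝ (⊤ : ℕ∞) p x := hp.contDiffAt hnhds
      have hux : ContDiffAt ℝ (⊤ : ℕ∞) u x := hu.contDiffAt hnhds
      have hbx : ContDiffAt ℝ (⊤ : ℕ∞) (fun y => bump ε (p y)) x :=
        (contDiff_bump ε).contDiffAt.comp x hpx
      have hfx : ContDiffAt ℝ (⊤ : ℕ∞) f x := hbx.smul hux
      have hgx : ContDiffAt ℝ (⊤ : ℕ∞) g x :=
        ((contDiff_bumpPrim ε).contDiffAt.comp x hpx).sub contDiffAt_const
      obtain ⟨h1, h2, h3⟩ := steadyEuler_modulate (φ := bump ε)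
        (Φ := fun s => bumpPrim ε s - bumpPrim ε (2 * ε))
        (hux.differentiableAt (by simp)) (hpx.differentiableAt (by simp))
        ((contDiff_bump ε (n := ⊤)).contDiffAt.differentiableAt (by simp))
        ((hasDerivAt_bumpPrim ε (p x)).sub_const _) (hdiv x hxOC) (hE x hxOC) (horth x hxOC)
      have hfdU : fderiv ℝ U x = fderiv ℝ f x := hUf.fderiv_eq
      have hfdP : fderiv ℝ P x = fderiv ℝ g x := hPg.fderiv_eq
      have hUx : U x = f x := hUf.eq_of_nhds
      refine ⟨hfx.congr_of_eventuallyEq hUf, hgx.congr_of_eventuallyEq hPg, ?_, ?_, ?_⟩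
      · simpa [VectorCalculus.divergence, hfdU] using h1
      · have hc : convect U U x = convect f f x := by simp [convect, hfdU, hUx]
        have hg' : gradient P x = gradient g x := by simp [gradient, hfdP]
        rw [hc, hg']
        exact h2
      · simp only [convect, hfdP, hUx]
        exact h3
  -- Step 7: a point with `p = 3ε/2` on the radial segment from `(R, 0, 0)` (intermediate values).
  obtain ⟨x₁, hx₁N, hx₁OC, hpx₁⟩ : ∃ x₁, x₁ ∈ N ∧ x₁ ∈ O \ C ∧ p x₁ = 3 * ε / 2 := by
    set e₀ : ℝ³ := EuclideanSpace.single 0 1 with he₀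
    set γ : ℝ → ℝ³ := fun t => (R + t) • e₀ with hγdef
    have hγ0 : ∀ t, γ t 0 = R + t := by intro t; simp [hγdef, he₀]
    have hγ1 : ∀ t, γ t 1 = 0 := by intro t; simp [hγdef, he₀]
    have hγ2 : ∀ t, γ t 2 = 0 := by intro t; simp [hγdef, he₀]
    have hγC : γ 0 ∈ C := by
      refine ⟨?_, hγ2 0⟩
      rw [cylRadius, hγ0, hγ1]
      simp [Real.sqrt_sq hR.le]
    have hγcont : Continuous γ := by
      rw [hγdef]; fun_prop
    have hγdist : ∀ t, dist (γ t) (γ 0) = |t| := by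
      intro t
      rw [dist_eq_norm, hγdef]
      simp only [add_zero, ← sub_smul, add_sub_cancel_left, norm_smul, Real.norm_eq_abs, he₀,
        PiLp.norm_single, norm_one, mul_one]
    have hγmem : ∀ t ∈ Icc (0 : ℝ) r, γ t ∈ cthickening r C := fun t ht =>
      mem_cthickening_of_dist_le _ _ _ _ hγC (by rw [hγdist, abs_of_nonneg ht.1]; exact ht.2)
    have hγr : γ r ∈ K₀ := by
      refine ⟨hγmem r ⟨hr.le, le_rfl⟩, fun h => ?_⟩
      obtain ⟨c, hc, hd⟩ := mem_thickening_iff.1 h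
      have hc2 : c 2 = 0 := hc.2
      have hc01 : c 0 ^ 2 + c 1 ^ 2 = R ^ 2 := by rw [← cylRadius_sq, hc.1]
      have hc0 : c 0 ≤ R := by
        have h' : |c 0| ≤ √(c 0 ^ 2 + c 1 ^ 2) := Real.abs_le_sqrt (by nlinarith [sq_nonneg (c 1)])
        rw [hc01, Real.sqrt_sq hR.le] at h'
        exact (le_abs_self _).trans h'
      have hdist : r ^ 2 ≤ dist (γ r) c ^ 2 := by
        rw [EuclideanSpace.dist_eq, Real.sq_sqrt (by positivity), Fin.sum_univ_three]
        simp only [hγ0, hγ1, hγ2, hc2, Real.dist_eq, sq_abs]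
        nlinarith [hc01, hc0, hr]
      have hle : r ≤ dist (γ r) c := by
        have := Real.sqrt_le_sqrt hdist
        rwa [Real.sqrt_sq hr.le, Real.sqrt_sq dist_nonneg] at this
      linarith
    have hpγ : ContinuousOn (fun t => p (γ t)) (Icc 0 r) :=
      hpc.comp hγcont.continuousOn fun t ht => hrO (hγmem t ht)
    have h0 : p (γ 0) = 0 := hp0 _ hγC
    have hrη : η ≤ p (γ r) := hηK _ hγr
    obtain ⟨t₁, ht₁, hpt₁⟩ : ∃ t₁ ∈ Icc (0 : ℝ) r, p (γ t₁) = 3 * ε / 2 := by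
      have hmem : (3 * ε / 2) ∈ Icc (p (γ 0)) (p (γ r)) := by
        rw [h0, hεdef]
        constructor <;> linarith
      exact intermediate_value_Icc hr.le hpγ hmem
    have hx₁T : γ t₁ ∈ T := ⟨hγmem t₁ ht₁, by show p (γ t₁) ≤ 2 * ε; rw [hpt₁]; linarith⟩
    refine ⟨γ t₁, hTN hx₁T, ⟨hTO hx₁T, fun hC => ?_⟩, hpt₁⟩
    have := hp0 _ hC
    rw [hpt₁] at this
    linarith
  have hswirl : swirl U x₁ ≠ 0 := by
    have hUx : U x₁ = bump ε (p x₁) • u x₁ := indicator_of_mem hx₁N f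
    have hsw' : swirl U x₁ = bump ε (p x₁) * swirl u x₁ := by
      simp only [swirl, hUx, PiLp.smul_apply, smul_eq_mul]
      ring
    rw [hsw']
    refine mul_ne_zero (bump_pos ?_ ?_).ne' (hsw x₁ hx₁OC)
    · rw [hpx₁]; linarith
    · rw [hpx₁]; linarith
  -- Step 8: assembly.
  refine ⟨U, P, contDiff_iff_contDiffAt.2 fun x => (hpt x).1,
    contDiff_iff_contDiffAt.2 fun x => (hpt x).2.1, ?_, ?_, ?_, ?_, ?_, ?_, ?_,
    fun x => (hpt x).2.2.1, fun x => (hpt x).2.2.2.1, fun x => (hpt x).2.2.2.2⟩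
  · exact hTc.of_isClosed_subset (isClosed_tsupport U) htsU
  · exact hTc.of_isClosed_subset (isClosed_tsupport P) htsP
  · intro hU
    apply hswirl
    simp [swirl, hU]
  · exact htsU.trans (hTr'.trans (thickening_mono hr'δ.le C))
  · -- (`rotZ θ (c • v) = c • rotZ θ v`, cf. `EulerTimeScaling.rotZ_smul`; three lines, not imported)
    have rotZ_smul : ∀ (θ c : ℝ) (v : ℝ³), rotZ θ (c • v) = c • rotZ θ v := fun θ c v => by
      ext i
      fin_cases i <;> simp <;> ring
    intro θ x
    by_cases hxN : x ∈ N
    · have h1 : rotZ θ x ∈ N := rotZ_mem_thickening_axisCircle_iff.2 hxN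
      rw [show U (rotZ θ x) = f (rotZ θ x) from indicator_of_mem h1 f,
        show U x = f x from indicator_of_mem hxN f, hfdef]
      simp only [hpa θ x (hNO hxN), hua θ x (hNO hxN), rotZ_smul]
    · have h1 : rotZ θ x ∉ N := fun h => hxN (rotZ_mem_thickening_axisCircle_iff.1 h)
      rw [show U (rotZ θ x) = 0 from indicator_of_notMem h1 f,
        show U x = 0 from indicator_of_notMem hxN f, rotZ_zero_vec]
  · intro θ x
    by_cases hxN : x ∈ N
    · have h1 : rotZ θ x ∈ N := rotZ_mem_thickening_axisCircle_iff.2 hxN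
      rw [show P (rotZ θ x) = g (rotZ θ x) from indicator_of_mem h1 g,
        show P x = g x from indicator_of_mem hxN g, hgdef]
      simp only [hpa θ x (hNO hxN)]
    · have h1 : rotZ θ x ∉ N := fun h => hxN (rotZ_mem_thickening_axisCircle_iff.1 h)
      rw [show P (rotZ θ x) = 0 from indicator_of_notMem h1 g,
        show P x = 0 from indicator_of_notMem hxN g]
  · exact fun h => hswirl (h x₁)

end Gavrilov

end Literature.Analysis.FluidPDE
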